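import Summits.KontsevichZagierPeriods.KontsevichZagierPeriods.Theses.TorsionLogs
import Summits.KontsevichZagierPeriods.KontsevichZagierPeriods.Theorems.TorsionLogsNeronTorsionSector
import Summits.KontsevichZagierPeriods.KontsevichZagierPeriods.Theorems.TorsionLogsTorsionSectorCompleteReductions
import Literature.NumberTheory.Transcendental.KZKernelConjectureForms

/-!
# Crux `TorsionSectorComplete` (stmt-KontsevichZagierPeriods-14212) — line `shifted_eta_sector`
# (forward generator G1 `next-rung` over the floor `NeronTorsionPrimitiveChain`, unit fwd2-rung-KontsevichZagierPeriods-01)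

Route `TorsionLogs` (route-KontsevichZagierPeriods-TorsionLogs; `closes (h₁ : NeronTorsionSector)
(h₂ : TorsionSectorComplete) : KontsevichZagierPeriods`, `h₁` CLOSED by the translation chain
`NeronTorsionSector_of = NeronTorsionSector_of_primitiveChain stub_assembly`, `h₂` the open residual, in tree
`TorsionSectorComplete ↔ KontsevichZagierPeriods` (`iff_summit_of_sector NeronTorsionSector_of`)).

## THE RUNG: the shifted η-carrier family `NeronTorsionShiftedSector ξ` (`ξ : ℚ`), floor = `ξ = 0`

FLOOR (seed g1-KontsevichZagierPeriods-17981, `…Cruxes.NeronTorsionSector.Translation.stub_assembly`, proved from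
thirty landed blocks): for a real curve `y² = f(x) = 4x³ − g₂x − g₃` whose LARGEST REAL ROOT IS POSITIVE, `0 < e₁`,
and a rational `N`-torsion point `P` on the identity component, the primitive chain
`q²•[rI] + p²•[rP] − c•[1<t<B, dt/t] ∈ KZ.relations`, where the quasi-period carrier of `rP` is the second-kind
density `h₀(x′) dx′/y′ = (g₂x′ + 2g₃) dx′/(4x′²y′)` — POLE AT `x′ = 0`, which must lie to the left of the
domain `(e₁, ∞)`: at `e₁ ≤ 0` the carrier is not integrable and the floor (and the tied crux `NeronTorsionSector`,
and the sector `T` of `TorsionSectorComplete`) say nothing. Since `e₁e₂e₃ = g₃/4`, the missing real curves are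
exactly `Δ < 0 ∧ g₃ ≤ 0` — e.g. `y² = 4x³ + 4` (`j = 0`, `e₁ = −1`, `P = (0, 1)` of order 3, `(2, 3)` of order 6).

RUNG (`NeronTorsionShiftedSectors := ∀ ξ : ℚ, NeronTorsionShiftedSector ξ`): the SAME tied statement with the
carrier moved to a rational pole `ξ < e₁`:
`h_ξ(x′) dx′/y′ = (g₂x′ + 2g₃ + ξ(g₂ − 4x′² − 4ξx′)) dx′ / (4(x′−ξ)²y′) = ½·d(y′/(x′−ξ)) − x′dx′/y′`,
so `h_ξ − h₀ = ½·d(ξy′/(x′(x′−ξ)))` is EXACT with a potential vanishing at `x′ = e₁` and at `∞`, and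
`∫_{e₁}^{∞} h_ξ dx′/y′ = η₁/2`-type complete quasi-period for every `ξ < e₁` (checked symbolically/numerically,
NOTES.md §CANDIDATES A). Member `ξ = 0` is LITERALLY `NeronTorsionSector` (`Rat.cast_zero`; witness
`neronTorsionShiftedSector_zero` below, 4 lines, names the seed). `ξ < e₁ ≤ 0` is the new regime.

* ON PATH (F4, proved below, `neronTorsionShiftedSectors_of_kontsevichZagierPeriods`): Conjecture 1 ⇒ every rung
  (kernel form `kzKernelConjecture_iff_isRational`: a tied element evaluates to `0` by its value hypothesis).
* REAL STEP (F7): the floor does not give the rung by instantiation (`e₁ ≤ 0` is outside its hypotheses; kernel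
  probe `floor → rung` open) — tribunal forward mode: `on_path=true real_step=true instantiation=null`.
* WHY THE FLOOR'S PROOF STOPS (Q4): `Theorems/TorsionLogsNeronTorsionSectorAssemblyIface.lean:105–120` bounds and
  regularises the kernel `(g₂t+2g₃)/(4t²)` on `(e₁,∞)` through `he₁pos : 0 < e₁`
  (`Cb := |g₂|/(4e₁) + |g₃|/(2e₁²)`, `cellStep_isSemialgebraicFunOn_kernel … (he₁pos.trans hp).ne'`);
  `Theorems/TorsionLogsNeronTorsionSectorStubParametersAlgebraic.lean:88` (`isAlgebraic_mul_of_integralRep`, `0 ≤ e₁`);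
  `Theorems/TorsionLogsNeronTorsionSectorStubTranslationCalculus.lean:84–102` (the translation identity `k3` is
  written for `h₀`). Replacement: the shifted kernel `k_ξ(t) = (g₂t+2g₃+ξ(g₂−4t²−4ξt))/(4(t−ξ)²)` is bounded,
  continuous and `ℚ`-semialgebraic on `(e₁,∞)` as soon as `ξ < e₁` (no sign condition), and the translation
  cocycle potential becomes `Ψ_ξ = Ψ₀ + τ_P^*φ − φ`, `φ = ξy/(2x(x−ξ))`.

## Stubs (3) and composition

* `stub_overlapSector`  — the rung on the OVERLAP regime `0 < e₁` (both carriers legal): floor + ONE exactness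
  move `[rP_ξ] − [rP₀] ∈ KZ.relations` (Newton–Leibniz in `x′` with the algebraic potential `ξy′/(2x′(x′−ξ))`,
  reps built by the landed `stub_haarReps` / `stub_parametersAlgebraic`). Size M.
* `stub_newRegimeChain` — the shifted PRIMITIVE CHAIN on the NEW regime `ξ < e₁ ≤ 0` (the floor's statement with
  `h_ξ`): re-run of the thirty-block translation chain with the shifted kernel. Size L–XL; the rung's content.
* `stub_shiftedComplete` — RESIDUAL: completeness of `KZ.relations ⊔ closure T^{sh}` for rational pairs, `T^{sh}` the
  tied SHIFTED elements (all `ξ`); weaker than the crux's own residual reading by monotonicity (`T ⊆ T^{sh}`);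
  conjecture-grade (Conjecture 1 modulo a larger explicit sector), declared `residual`.
* PROVED here (no `sorry`): the bookkeeping `shiftedSector_of_shiftedChain` (verbatim transport of the landed
  `NeronTorsionSector_of_primitiveChain`: coprimality tie, soundness, Hermite–Lindemann–Baker log calculus),
  `neronTorsionShiftedSectors_of` (rung from stubs 1–2), `closure_shiftedTied_le_relations`, and the composition
  `TorsionSectorComplete_of` concluding the crux BY NAME; plus the F3 witness and the F4 on-path lemma.

Disproof used: none exists for stmt-14212 (`ledger crux ls`: no `Disproof.lean`, no `Negative/`); negatives index of
the summit: 1 entry (stmt-5394 `KinematicFormulas`, unrelated). Dead lines avoided: none registered dead on 14212;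
this line differs from `birth` (surface-layer descent, stuck on `stub_surfaceKernel` = dimension-≤2 kernel) and
`ayoub_cube` (effective cube kernel) by NOT cutting the kernel at all: it ENLARGES THE PROVED SECTOR by an explicit
family and leaves the same-shaped residual — the forward generator's contract.
## FORWARD keys (F6) and tribunal kernel

FORWARD: generator=rung ; seed=g1-KontsevichZagierPeriods-17981 (stmt-KontsevichZagierPeriods-17981 `NeronTorsionPrimitiveChain`) ;
witness=Summit.KontsevichZagierPeriods.KontsevichZagierPeriods.Cruxes.TorsionSectorComplete.ShiftedEtaSector.neronTorsionShiftedSector_zero ;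
rung_of=NeronTorsionPrimitiveChain (`…Cruxes.NeronTorsionSector.Translation.stub_assembly`, via the landed
`NeronTorsionSector_of_primitiveChain`) ;
rung_decl=Summit.KontsevichZagierPeriods.KontsevichZagierPeriods.Cruxes.TorsionSectorComplete.ShiftedEtaSector.NeronTorsionShiftedSectors ;
special_file=lean/Summits/KontsevichZagierPeriods/KontsevichZagierPeriods/Cruxes/TorsionSectorComplete/Lines/NeronTorsionShiftedSectors_special.lean ;
onpath_file=lean/Summits/KontsevichZagierPeriods/KontsevichZagierPeriods/Cruxes/TorsionSectorComplete/Lines/NeronTorsionShiftedSectors_onpath.lean ;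
step=hypothesis: `0 < e₁` ↦ `(ξ:ℝ) < e₁` for a rational carrier pole `ξ` (the η-carrier `h₀ dx′/y′` ↦ `h_ξ dx′/y′`) ;
gap_after=next rung = two torsion corners (triangle `x(P₂) < x′ < x < x(P₁)`, third period type `R·ω₁`) and the
egg component (`Δ > 0`, `P` on the bounded oval); then non-rational torsion fields / CM correspondences / isogenies
(route IsogenyCertificates); the Statement needs ALL of `ker eval`, i.e. Conjecture 1 itself (residual) ;
witness_regime=real Weierstrass models over `ℚ̄ ∩ ℝ` with a rational torsion point and `Δ < 0 ∧ g₃ ≤ 0`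
(`e₁ ≤ 0`); S known there: no — Conjecture 1 is open for every non-trivial family, and the rung's value identity
is QUADRATIC in 1-periods (`I(P)`, `ω₁η₁`, `log α`), outside the proved linear theory of 1-periods
(Huber–Wüstholz, Thm 9.10 / Thm 13.3; "P¹ is not closed under multiplication", Rem. 13.2(3)) ;
method_family=explicit-kz-move-chains torsion-translation-cocycle genus-one-second-kind-iterated-integrals
fibrewise-newton-leibniz-with-algebraic-potentials baker-hermite-lindemann-logs ;
ladder_ceiling=capped-at-<period relations of 1-motives induced by bilinearity and functoriality for EXPLICIT
algebraic correspondences (torsion translations, isogenies, CM), realised correspondence by correspondence> ;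
ceiling_lift=a uniform move-realisation theorem for 1-motivic functoriality, and the Grothendieck period
conjecture beyond 1-motives — none declared here (the residual `stub_shiftedComplete` carries it) ;
ceiling_sources=[corpus:book:huber2022-transcendence-linear-relations-1-periods p.91 Thm 9.10; ibid. p.121
Conj 13.1 + Rem 13.2(3); Literature/Barriers/KontsevichZagierPeriods/GrothendieckPeriodConjectureDependence.lean;
Literature/Barriers/KontsevichZagierPeriods/AlgebraicPrimitivesObstruction.lean; galaxy:panama:366360710348844] ;
disposition=frontier ; residual=ShiftedSectorComplete (`stub_shiftedComplete`) ;
nearest=route-KontsevichZagierPeriods-TorsionLogs: same translation-cocycle lever, carrier pole moved off `x′ = 0`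
to a rational `ξ < e₁` — the proved sector is enlarged to the curves with `e₁ ≤ 0`.

Tribunal kernel (forward mode, FULL tier, `#h21_tribunal` engine-79a97a0c, probe from the sorry-free Sketch with
the same decl names, floor `…Translation.stub_assembly`, witness `neronTorsionShiftedSector_zero`): VERDICT
provisional, fail_grounds [], `forward on_path=true real_step=true`, instantiation null, same_rung_by null,
t1h clean, t1b `C → S` open / `S → C` closed (`intro h; aesop`, via the `@[simp]` on-path lemma), t1c clean
(5 strong hypotheses open), t-carrier clean (binders `rI`, `rL` inhabited), t3k present (`NeronTorsionShiftedSector 0`).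

[cite: KontsevichZagier2001, §1.2] [cite: Lang1983, Ch. 13 Thm 1.1] [cite: Lawden1989, §6.8, §6.11–6.12]
-/

noncomputable section

open Set MeasureTheory Filter Topology
open Literature.NumberTheory.Transcendental Literature.ModelTheory.ExponentialFields
open Summit.KontsevichZagierPeriods.KontsevichZagierPeriods.Theses.TorsionLogs (NeronTorsionSector TorsionSectorComplete)
open Summit.KontsevichZagierPeriods.HyperbolicBloch.OffTetraSectorKernel (exists_logRep
  interval_log_relation_mem_relations hermiteLindemann_evalP_log)
open Summit.KontsevichZagierPeriods.KontsevichZagierPeriods.Cruxes.NeronTorsionSector.Translation (logRep_value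
  isAlgebraic_of_logRep NeronTorsionSector_of_primitiveChain stub_assembly NeronTorsionSector_of)

-- `Summit.KontsevichZagierPeriods.KontsevichZagierPeriods.…` is the tree's mandated layout (single-conjunct summit).
set_option linter.dupNamespace false

namespace Summit.KontsevichZagierPeriods.KontsevichZagierPeriods.Cruxes.TorsionSectorComplete.ShiftedEtaSector

/-! ### The rung family -/

/-- The tied Néron–torsion sector with the η-carrier shifted to the rational pole `x′ = ξ < e₁`
(`NeronTorsionSector` verbatim except `0 < e₁ ↦ (ξ:ℝ) < e₁` and the carrier `h₀ ↦ h_ξ`). [cite: KontsevichZagier2001, §1.2] -/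
def NeronTorsionShiftedSector (ξ : ℚ) : Prop :=
  ∀ (g₂ g₃ e₁ xP yP α : ℝ) (N a : ℕ) (M k m : ℤ) (f : ℝ → ℝ), (∀ x, f x = 4 * x ^ 3 - g₂ * x - g₃) → g₂ ^ 3 - 27 * g₃ ^ 2 ≠ 0 → f e₁ = 0 → (ξ : ℝ) < e₁ → (∀ x, e₁ < x → 0 < f x) → e₁ < xP → yP ^ 2 = f xP → 3 ≤ N → 0 < a → 2 * a < N → 4 * (N : ℤ) ^ 2 * k = M * ((N : ℤ) - 2 * (a : ℤ)) ^ 2 → (∀ hns : (⟨0, 0, 0, -g₂ / 4, -g₃ / 4⟩ : WeierstrassCurve ℝ).toAffine.Nonsingular xP (yP / 2), addOrderOf (WeierstrassCurve.Affine.Point.some xP (yP / 2) hns) = N) → (N : ℝ) * (∫ x in Set.Ioi xP, (Real.sqrt (f x))⁻¹) = a * (2 * ∫ x in Set.Ioi e₁, (Real.sqrt (f x))⁻¹) → 1 < α → ∀ (rI rP : Literature.NumberTheory.Transcendental.KZ.IntegralRep 2) (rL : Literature.NumberTheory.Transcendental.KZ.IntegralRep 1), rI.domain = {z | e₁ < z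 1 ∧ z 1 < z 0 ∧ z 0 < xP} → Set.EqOn rI.integrand (fun z => z 1 / (Real.sqrt (f (z 1)) * Real.sqrt (f (z 0)))) rI.domain → rP.domain = {z | e₁ < z 0 ∧ e₁ < z 1} → Set.EqOn rP.integrand (fun z => (Real.sqrt (f (z 0)))⁻¹ * ((g₂ * z 1 + 2 * g₃ + (ξ : ℝ) * (g₂ - 4 * (z 1) ^ 2 - 4 * (ξ : ℝ) * z 1)) / (2 * (z 1 - (ξ : ℝ)) ^ 2 * Real.sqrt (f (z 1))))) rP.domain → rL.domain = {t | 1 < t 0 ∧ t 0 < α} → Set.EqOn rL.integrand (fun t => (t 0)⁻¹) rL.domain → (M : ℝ) * rI.value + k * rP.value = m * rL.value → M • Literature.NumberTheory.Transcendental.KZ.of rI + k • Literature.NumberTheory.Transcendental.KZ.of rP - m • Literature.NumberTheory.Transcendental.KZ.of rL ∈ Literature.NumberTheory.Transcendental.KZ.relations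

/-- **THE RUNG** (`rung_decl`): the shifted Néron–torsion sector for every rational pole `ξ`. -/
def NeronTorsionShiftedSectors : Prop :=
  ∀ ξ : ℚ, NeronTorsionShiftedSector ξ

/-- The set `T^{sh}` of tied SHIFTED Néron–torsion elements (all rational poles `ξ < e₁`). -/
def ShiftedTied : Set Literature.NumberTheory.Transcendental.KZ.FormalRep :=
  {d | ∃ (ξ : ℚ) (g₂ g₃ e₁ xP yP α : ℝ) (N a : ℕ) (M k m : ℤ) (f : ℝ → ℝ) (rI rP : Literature.NumberTheory.Transcendental.KZ.IntegralRep 2) (rL : Literature.NumberTheory.Transcendental.KZ.IntegralRep 1), (∀ x, f x = 4 * x ^ 3 - g₂ * x - g₃) ∧ g₂ ^ 3 - 27 * g₃ ^ 2 ≠ 0 ∧ f e₁ = 0 ∧ (ξ : ℝ) < e₁ ∧ (∀ x, e₁ < x → 0 < f x) ∧ e₁ < xP ∧ yP ^ 2 = f xP ∧ 3 ≤ N ∧ 0 < a ∧ 2 * a < N ∧ 4 * (N : ℤ) ^ 2 * k = M * ((N : ℤ) - 2 * (a : ℤ)) ^ 2 ∧ (∀ hns : (⟨0, 0, 0, -g₂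 / 4, -g₃ / 4⟩ : WeierstrassCurve ℝ).toAffine.Nonsingular xP (yP / 2), addOrderOf (WeierstrassCurve.Affine.Point.some xP (yP / 2) hns) = N) ∧ (N : ℝ) * (∫ x in Set.Ioi xP, (Real.sqrt (f x))⁻¹) = a * (2 * ∫ x in Set.Ioi e₁, (Real.sqrt (f x))⁻¹) ∧ 1 < α ∧ rI.domain = {z | e₁ < z 1 ∧ z 1 < z 0 ∧ z 0 < xP} ∧ Set.EqOn rI.integrand (fun z => z 1 / (Real.sqrt (f (z 1)) * Real.sqrt (f (z 0)))) rI.domain ∧ rP.domain = {z | e₁ < z 0 ∧ e₁ < z 1} ∧ Set.EqOn rP.integrand (fun z => (Real.sqrt (f (z 0)))⁻¹ * ((g₂ * z 1 + 2 * g₃ + (ξ : ℝ) * (g₂ - 4 * (z 1) ^ 2 - 4 * (ξ : ℝ) * z 1)) / (2 * (z 1 - (ξ : ℝ)) ^ 2 * Real.sqrt (f (z 1))))) rP.domain ∧ rL.domain = {t | 1 < t 0 ∧ t 0 < α} ∧ Set.EqOn rL.integrand (fun t => (t 0)⁻¹) rL.domain ∧ (M : ℝ) * rI.value + k * rP.value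 = m * rL.value ∧ d = M • Literature.NumberTheory.Transcendental.KZ.of rI + k • Literature.NumberTheory.Transcendental.KZ.of rP - m • Literature.NumberTheory.Transcendental.KZ.of rL}

/-- **RESIDUAL** `ShiftedSectorComplete`: completeness of the KZ calculus relative to the SHIFTED sector. -/
def ShiftedSectorComplete : Prop :=
  ∀ ⦃n m : ℕ⦄ (r : Literature.NumberTheory.Transcendental.KZ.IntegralRep n) (r' : Literature.NumberTheory.Transcendental.KZ.IntegralRep m), r.IsRational → r'.IsRational → r.value = r'.value → Literature.NumberTheory.Transcendental.KZ.of r - Literature.NumberTheory.Transcendental.KZ.of r' ∈ Literature.NumberTheory.Transcendental.KZ.relations ⊔ AddSubgroup.closure ShiftedTied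

/-- Stub 1's statement: the rung on the OVERLAP regime `0 < e₁`. -/
def OverlapSector : Prop :=
  ∀ (ξ : ℚ) (g₂ g₃ e₁ xP yP α : ℝ) (N a : ℕ) (M k m : ℤ) (f : ℝ → ℝ), (∀ x, f x = 4 * x ^ 3 - g₂ * x - g₃) → g₂ ^ 3 - 27 * g₃ ^ 2 ≠ 0 → f e₁ = 0 → 0 < e₁ → (ξ : ℝ) < e₁ → (∀ x, e₁ < x → 0 < f x) → e₁ < xP → yP ^ 2 = f xP → 3 ≤ N → 0 < a → 2 * a < N → 4 * (N : ℤ) ^ 2 * k = M * ((N : ℤ) - 2 * (a : ℤ)) ^ 2 → (∀ hns : (⟨0, 0, 0, -g₂ / 4, -g₃ / 4⟩ : WeierstrassCurve ℝ).toAffine.Nonsingular xP (yP / 2), addOrderOf (WeierstrassCurve.Affine.Point.some xP (yP / 2) hns) = N) → (N : ℝ) * (∫ x in Set.Ioi xP, (Real.sqrt (f x))⁻¹) = a * (2 * ∫ x in Set.Ioi e₁, (Real.sqrt (f x))⁻¹) → 1 < α → ∀ (rI rP : Literature.NumberTheory.Transcendental.KZ.IntegralRep 2) (rL : Literature.NumberTheory.Transcendental.KZ.IntegralRep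 1), rI.domain = {z | e₁ < z 1 ∧ z 1 < z 0 ∧ z 0 < xP} → Set.EqOn rI.integrand (fun z => z 1 / (Real.sqrt (f (z 1)) * Real.sqrt (f (z 0)))) rI.domain → rP.domain = {z | e₁ < z 0 ∧ e₁ < z 1} → Set.EqOn rP.integrand (fun z => (Real.sqrt (f (z 0)))⁻¹ * ((g₂ * z 1 + 2 * g₃ + (ξ : ℝ) * (g₂ - 4 * (z 1) ^ 2 - 4 * (ξ : ℝ) * z 1)) / (2 * (z 1 - (ξ : ℝ)) ^ 2 * Real.sqrt (f (z 1))))) rP.domain → rL.domain = {t | 1 < t 0 ∧ t 0 < α} → Set.EqOn rL.integrand (fun t => (t 0)⁻¹) rL.domain → (M : ℝ) * rI.value + k * rP.value = m * rL.value → M • Literature.NumberTheory.Transcendental.KZ.of rI + k • Literature.NumberTheory.Transcendental.KZ.of rP - m • Literature.NumberTheory.Transcendental.KZ.of rL ∈ Literature.NumberTheory.Transcendental.KZ.relations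

/-- Stub 2's statement for one pole `ξ`: the shifted PRIMITIVE CHAIN on the NEW regime `ξ < e₁ ≤ 0`
(the floor `stub_assembly` verbatim except `0 < e₁ ↦ (ξ:ℝ) < e₁ → e₁ ≤ 0` and `h₀ ↦ h_ξ`). -/
def NewRegimeChainAt (ξ : ℚ) : Prop :=
  ∀ (g₂ g₃ e₁ xP yP : ℝ) (N a p q : ℕ) (f : ℝ → ℝ),
      (∀ x, f x = 4 * x ^ 3 - g₂ * x - g₃) → g₂ ^ 3 - 27 * g₃ ^ 2 ≠ 0 → f e₁ = 0 → (ξ : ℝ) < e₁ → e₁ ≤ 0 →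
      (∀ x, e₁ < x → 0 < f x) → e₁ < xP → yP ^ 2 = f xP → 3 ≤ N → 0 < a → 2 * a < N →
      (∀ hns : (⟨0, 0, 0, -g₂ / 4, -g₃ / 4⟩ : WeierstrassCurve ℝ).toAffine.Nonsingular xP (yP / 2),
      addOrderOf (WeierstrassCurve.Affine.Point.some xP (yP / 2) hns) = N) →
      (N : ℝ) * (∫ x in Set.Ioi xP, (Real.sqrt (f x))⁻¹) = a * (2 * ∫ x in Set.Ioi e₁, (Real.sqrt (f x))⁻¹) →
      Nat.Coprime p q → (q : ℤ) * ((N : ℤ) - 2 * (a : ℤ)) = (p : ℤ) * (2 * (N : ℤ)) →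
      ∀ (rI rP : Literature.NumberTheory.Transcendental.KZ.IntegralRep 2),
      rI.domain = {z | e₁ < z 1 ∧ z 1 < z 0 ∧ z 0 < xP} →
      Set.EqOn rI.integrand (fun z => z 1 / (Real.sqrt (f (z 1)) * Real.sqrt (f (z 0)))) rI.domain →
      rP.domain = {z | e₁ < z 0 ∧ e₁ < z 1} →
      Set.EqOn rP.integrand
      (fun z => (Real.sqrt (f (z 0)))⁻¹ * ((g₂ * z 1 + 2 * g₃ + (ξ : ℝ) * (g₂ - 4 * (z 1) ^ 2 - 4 * (ξ : ℝ) * z 1)) / (2 * (z 1 - (ξ : ℝ)) ^ 2 * Real.sqrt (f (z 1))))) rP.domain →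
      ∃ (c : ℤ) (B : ℝ) (rB : Literature.NumberTheory.Transcendental.KZ.IntegralRep 1), 1 < B ∧ IsAlgebraic ℚ B ∧
      rB.domain = {t | 1 < t 0 ∧ t 0 < B} ∧ Set.EqOn rB.integrand (fun t => (t 0)⁻¹) rB.domain ∧
      ((q : ℤ) ^ 2) • Literature.NumberTheory.Transcendental.KZ.of rI + ((p : ℤ) ^ 2) • Literature.NumberTheory.Transcendental.KZ.of rP - c • Literature.NumberTheory.Transcendental.KZ.of rB ∈ Literature.NumberTheory.Transcendental.KZ.relations

/-! ### Registered stubs -/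

/-- **Stub 1 (M) — the rung on the overlap regime `0 < e₁`.** Both carriers `h₀`, `h_ξ` are legal; given the
tied shifted data, build `rP₀ = [e₁<x, e₁<x′, h₀(x′)dx dx′/(y y′)]` (`stub_parametersAlgebraic` from `rI`,
`stub_haarReps`), show `[rP_ξ] − [rP₀] ∈ KZ.relations` by ONE Newton–Leibniz move in `x′` (potential
`ξy′/(2x′(x′−ξ))`, algebraic, vanishing at `x′ = e₁` and at `∞`, after the semialgebraic compactification
`x′ ↦ 1/(x′−e₁+1)` used by the floor's corner chart) plus integrand additivity, transfer the value hypothesis by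
soundness, and add `k•([rP_ξ] − [rP₀])` to the landed `NeronTorsionSector_of`. Why plausibly true: it is the floor
plus one exact form. [cite: KontsevichZagier2001, §1.2 rule (3)] -/
theorem stub_overlapSector :
    ∀ (ξ : ℚ) (g₂ g₃ e₁ xP yP α : ℝ) (N a : ℕ) (M k m : ℤ) (f : ℝ → ℝ), (∀ x, f x = 4 * x ^ 3 - g₂ * x - g₃) → g₂ ^ 3 - 27 * g₃ ^ 2 ≠ 0 → f e₁ = 0 → 0 < e₁ → (ξ : ℝ) < e₁ → (∀ x, e₁ < x → 0 < f x) → e₁ < xP → yP ^ 2 = f xP → 3 ≤ N → 0 < a → 2 * a < N → 4 * (N : ℤ) ^ 2 * k = M * ((N : ℤ) - 2 * (a : ℤ)) ^ 2 → (∀ hns : (⟨0, 0, 0, -g₂ / 4, -g₃ / 4⟩ : WeierstrassCurve ℝ).toAffine.Nonsingular xP (yP / 2), addOrderOf (WeierstrassCurve.Affine.Point.some xP (yP / 2) hns) = N) → (N : ℝ) * (∫ x in Set.Ioi xP, (Real.sqrt (f x))⁻¹) = a * (2 * ∫ x in Set.Ioi e₁, (Real.sqrt (f x))⁻¹) → 1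 < α → ∀ (rI rP : Literature.NumberTheory.Transcendental.KZ.IntegralRep 2) (rL : Literature.NumberTheory.Transcendental.KZ.IntegralRep 1), rI.domain = {z | e₁ < z 1 ∧ z 1 < z 0 ∧ z 0 < xP} → Set.EqOn rI.integrand (fun z => z 1 / (Real.sqrt (f (z 1)) * Real.sqrt (f (z 0)))) rI.domain → rP.domain = {z | e₁ < z 0 ∧ e₁ < z 1} → Set.EqOn rP.integrand (fun z => (Real.sqrt (f (z 0)))⁻¹ * ((g₂ * z 1 + 2 * g₃ + (ξ : ℝ) * (g₂ - 4 * (z 1) ^ 2 - 4 * (ξ : ℝ) * z 1)) / (2 * (z 1 - (ξ : ℝ)) ^ 2 * Real.sqrt (f (z 1))))) rP.domain → rL.domain = {t | 1 < t 0 ∧ t 0 < α} → Set.EqOn rL.integrand (fun t => (t 0)⁻¹) rL.domain → (M : ℝ) * rI.value + k * rP.value = m * rL.value → M • Literature.NumberTheory.Transcendental.KZ.of rI + k • Literature.NumberTheory.Transcendental.KZ.of rP - m • Literature.NumberTheory.Transcendental.KZ.of rL ∈ Literature.NumberTheory.Transcendental.KZ.relations := by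
  sorry

/-- **Stub 2 (L–XL, the rung's content) — the shifted primitive chain on the new regime `ξ < e₁ ≤ 0`.**
Re-run of the floor's translation chain (`Cruxes/NeronTorsionSector/Lines/birth.lean` v6, thirty landed blocks)
with the kernel `k_ξ(t) = (g₂t+2g₃+ξ(g₂−4t²−4ξt))/(4(t−ξ)²)` in place of `(g₂t+2g₃)/(4t²)`: `k_ξ` is bounded,
continuous and `ℚ`-semialgebraic on `(e₁,∞)` because `ξ < e₁` (replacing `AssemblyIface.lean:105–120`, which needs
`0 < e₁`), the translation identity holds with the potential `Ψ_ξ = Ψ₀ + τ_P^*φ − φ`, `φ = ξy/(2x(x−ξ))`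
(replacing `StubTranslationCalculus.lean:84–102`), and `isAlgebraic_mul_of_integralRep` is used without its `0 ≤ e₁`.
Torsion grid, Haar representations, corner chart at infinity, log steps and period symmetry are kernel-independent.
Why plausibly true: it is an instance of Conjecture 1 (`neronTorsionShiftedSectors_of_kontsevichZagierPeriods`) and
the Néron/Klein value identity behind the floor is regime-independent. Why it might fail AS A PROOF PLAN: the corner
chart's decay estimate used `|h₀(t)| ≤ Cb` with `h₀ → 0` at `∞`, whereas `k_ξ → −ξ` — a constant tail that the
column/row telescoping must absorb (first place to check: `AssemblyCorner*.lean`).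
[cite: KontsevichZagier2001, §1.2] [cite: Lawden1989, §6.8, §6.11–6.12] -/
theorem stub_newRegimeChain : ∀ ξ : ℚ, NewRegimeChainAt ξ := by
  sorry

/-- **Stub 3 (residual, conjecture-grade) — completeness relative to the SHIFTED sector.** For rational `r`, `r'`
of equal value, `[r] − [r'] ∈ KZ.relations ⊔ closure T^{sh}`. Weaker than the crux's residual reading
(`T ⊆ T^{sh}` termwise at `ξ = 0`), a consequence of the summit (`of_summit` + monotonicity), in substance Conjecture 1
modulo an explicit, now larger, proved sector: declared `residual`. Why it might fail: it cannot fail short of the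
summit failing; it can fail to be PROVABLE by any known method (Ayoub / Huber–Müller-Stach: the kernel of the period
map is not known to be generated by explicit sectors). [cite: KontsevichZagier2001, §1.2] [cite: Ayoub2014, Cor. 32] -/
theorem stub_shiftedComplete : ShiftedSectorComplete := by
  sorry

/-! ### Proved infrastructure (no `sorry` below this line) -/

/-- **Bookkeeping, transported verbatim from the landed `NeronTorsionSector_of_primitiveChain`** (the proof never
inspects the carrier of `rP` nor the sign of `e₁`): the shifted primitive chain on a regime gives the tied shifted
sector on that regime — coprimality tie `(M, k) = s·(q², p²)`, soundness of the calculus, Hermite–Lindemann for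
`log` of a real algebraic number, the landed interval-log calculus. [cite: KontsevichZagier2001, §1.2] [cite: Lang1983, Ch. 13 Thm 1.1] -/
theorem shiftedSector_of_shiftedChain (ξ : ℚ) (hPC : NewRegimeChainAt ξ) :
    ∀ (g₂ g₃ e₁ xP yP α : ℝ) (N a : ℕ) (M k m : ℤ) (f : ℝ → ℝ), (∀ x, f x = 4 * x ^ 3 - g₂ * x - g₃) → g₂ ^ 3 - 27 * g₃ ^ 2 ≠ 0 → f e₁ = 0 → (ξ : ℝ) < e₁ → e₁ ≤ 0 → (∀ x, e₁ < x → 0 < f x) → e₁ < xP → yP ^ 2 = f xP → 3 ≤ N → 0 < a → 2 * a < N → 4 * (N : ℤ) ^ 2 * k = M * ((N : ℤ) - 2 * (a : ℤ)) ^ 2 → (∀ hns : (⟨0, 0, 0, -g₂ / 4, -g₃ / 4⟩ : WeierstrassCurve ℝ).toAffine.Nonsingular xP (yP / 2), addOrderOf (WeierstrassCurve.Affine.Point.some xP (yP / 2) hns) = N) → (N : ℝ) * (∫ x in Set.Ioi xP, (Real.sqrt (f x))⁻¹) = a * (2 * ∫ x in Set.Ioi e₁, (Real.sqrt (f x))⁻¹)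 → 1 < α → ∀ (rI rP : Literature.NumberTheory.Transcendental.KZ.IntegralRep 2) (rL : Literature.NumberTheory.Transcendental.KZ.IntegralRep 1), rI.domain = {z | e₁ < z 1 ∧ z 1 < z 0 ∧ z 0 < xP} → Set.EqOn rI.integrand (fun z => z 1 / (Real.sqrt (f (z 1)) * Real.sqrt (f (z 0)))) rI.domain → rP.domain = {z | e₁ < z 0 ∧ e₁ < z 1} → Set.EqOn rP.integrand (fun z => (Real.sqrt (f (z 0)))⁻¹ * ((g₂ * z 1 + 2 * g₃ + (ξ : ℝ) * (g₂ - 4 * (z 1) ^ 2 - 4 * (ξ : ℝ) * z 1)) / (2 * (z 1 - (ξ : ℝ)) ^ 2 * Real.sqrt (f (z 1))))) rP.domain → rL.domain = {t | 1 < t 0 ∧ t 0 < α} → Set.EqOn rL.integrand (fun t => (t 0)⁻¹) rL.domain → (M : ℝ) * rI.value + k * rP.value = m * rL.value → M • Literature.NumberTheory.Transcendental.KZ.of rI + k • Literature.NumberTheory.Transcendental.KZ.of rP - m • Literature.NumberTheory.Transcendental.KZ.of rL ∈ Literature.NumberTheory.Transcendental.KZ.relations := by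
  intro g₂ g₃ e₁ xP yP α N a M k m f hf hdisc he hξ hR hpos hx hy hN ha ha2 htie htor hρ hα rI rP rL hdI hiI
    hdP hiP hdL hiL hval
  -- reduced exponents `ρ = (N − 2a)/(2N) = p/q`
  have h2a : 2 * a ≤ N := by omega
  obtain ⟨p, q, hcop, hpqN, hq0⟩ :
      ∃ p q : ℕ, Nat.Coprime p q ∧ q * (N - 2 * a) = p * (2 * N) ∧ 0 < q := by
    have hg0 : 0 < Nat.gcd (N - 2 * a) (2 * N) := Nat.gcd_pos_of_pos_right _ (by omega)
    refine ⟨(N - 2 * a) / Nat.gcd (N - 2 * a) (2 * N), (2 * N) / Nat.gcd (N - 2 * a) (2 * N),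
      Nat.coprime_div_gcd_div_gcd hg0, ?_, ?_⟩
    · have hp' : (N - 2 * a) / Nat.gcd (N - 2 * a) (2 * N) * Nat.gcd (N - 2 * a) (2 * N) = N - 2 * a :=
        Nat.div_mul_cancel (Nat.gcd_dvd_left _ _)
      have hq' : (2 * N) / Nat.gcd (N - 2 * a) (2 * N) * Nat.gcd (N - 2 * a) (2 * N) = 2 * N :=
        Nat.div_mul_cancel (Nat.gcd_dvd_right _ _)
      calc (2 * N) / Nat.gcd (N - 2 * a) (2 * N) * (N - 2 * a)
          = (2 * N) / Nat.gcd (N - 2 * a) (2 * N) *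
              ((N - 2 * a) / Nat.gcd (N - 2 * a) (2 * N) * Nat.gcd (N - 2 * a) (2 * N)) := by rw [hp']
        _ = (N - 2 * a) / Nat.gcd (N - 2 * a) (2 * N) *
              ((2 * N) / Nat.gcd (N - 2 * a) (2 * N) * Nat.gcd (N - 2 * a) (2 * N)) := by ring
        _ = (N - 2 * a) / Nat.gcd (N - 2 * a) (2 * N) * (2 * N) := by rw [hq']
    · exact Nat.div_pos (Nat.le_of_dvd (by omega) (Nat.gcd_dvd_right _ _)) hg0
  have hpqZ : (q : ℤ) * ((N : ℤ) - 2 * (a : ℤ)) = (p : ℤ) * (2 * (N : ℤ)) := by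
    have h := congrArg (Nat.cast : ℕ → ℤ) hpqN
    push_cast [Nat.cast_sub h2a] at h
    linarith
  -- the tie: `(M, k) = s • (q², p²)`
  have hN0 : (N : ℤ) ≠ 0 := by exact_mod_cast (show N ≠ 0 by omega)
  have hqk : (q : ℤ) ^ 2 * k = (p : ℤ) ^ 2 * M := by
    have h4 : (4 : ℤ) * (N : ℤ) ^ 2 ≠ 0 := mul_ne_zero (by norm_num) (pow_ne_zero 2 hN0)
    apply mul_left_cancel₀ h4
    calc 4 * (N : ℤ) ^ 2 * ((q : ℤ) ^ 2 * k) = (q : ℤ) ^ 2 * (4 * (N : ℤ) ^ 2 * k) := by ring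
      _ = (q : ℤ) ^ 2 * (M * ((N : ℤ) - 2 * (a : ℤ)) ^ 2) := by rw [htie]
      _ = M * ((q : ℤ) * ((N : ℤ) - 2 * (a : ℤ))) ^ 2 := by ring
      _ = M * ((p : ℤ) * (2 * (N : ℤ))) ^ 2 := by rw [hpqZ]
      _ = 4 * (N : ℤ) ^ 2 * ((p : ℤ) ^ 2 * M) := by ring
  have hcopZ : IsCoprime ((q : ℤ) ^ 2) ((p : ℤ) ^ 2) := by
    have h := Nat.isCoprime_iff_coprime.mpr (hcop.symm.pow 2 2)
    push_cast at h
    exact h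
  obtain ⟨s, hs⟩ : (q : ℤ) ^ 2 ∣ M :=
    hcopZ.dvd_of_dvd_mul_left ⟨k, by linear_combination -hqk⟩
  have hq0Z : (q : ℤ) ^ 2 ≠ 0 := pow_ne_zero 2 (by exact_mod_cast hq0.ne')
  have hk : k = (p : ℤ) ^ 2 * s := by
    apply mul_left_cancel₀ hq0Z
    rw [hqk, hs]
    ring
  -- the primitive chain and its value
  obtain ⟨c, B, rB, hB, hBalg, hdB, hiB, hprim⟩ :=
    hPC g₂ g₃ e₁ xP yP N a p q f hf hdisc he hξ hR hpos hx hy hN ha ha2 htor hρ hcop hpqZ rI rP hdI hiI hdP hiP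
  have hvB : rB.value = Real.log B := logRep_value hB.le rB hdB hiB
  have hvL : rL.value = Real.log α := logRep_value hα.le rL hdL hiL
  have hαalg : IsAlgebraic ℚ α := isAlgebraic_of_logRep hα rL hdL
  have h0 : (q : ℝ) ^ 2 * rI.value + (p : ℝ) ^ 2 * rP.value - c * Real.log B = 0 := by
    have h := KZ.relations_le_ker_eval_holds hprim
    rw [AddMonoidHom.mem_ker] at h
    simpa only [map_add, map_sub, map_zsmul, KZ.eval_of, zsmul_eq_mul, Int.cast_pow, Int.cast_natCast,
      hvB] using h
  -- the value hypothesis becomes a relation between two logarithms of algebraic numbers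
  have hlog : (s : ℝ) * c * Real.log B - m * Real.log α = 0 := by
    have hM : (M : ℝ) = (q : ℝ) ^ 2 * s := by
      rw [hs]
      push_cast
      ring
    have hK : (k : ℝ) = (p : ℝ) ^ 2 * s := by
      rw [hk]
      push_cast
      ring
    rw [hM, hK, hvL] at hval
    linear_combination hval - (s : ℝ) * h0
  -- landed log calculus: `(s c)•[rB] − m•[rL] ∈ relations`
  have hiB1 : Set.EqOn rB.integrand (fun t : Fin 1 → ℝ => 1 / t 0) rB.domain := fun t ht => by
    simp only [hiB ht, one_div]
  have hiL1 : Set.EqOn rL.integrand (fun t : Fin 1 → ℝ => 1 / t 0) rL.domain := fun t ht => by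
    simp only [hiL ht, one_div]
  have hL : (s * c) • KZ.of rB - m • KZ.of rL ∈ KZ.relations := by
    have h := interval_log_relation_mem_relations 2 ![1, 1] ![B, α] ![s * c, -m] ![rB, rL]
      (fun i => by fin_cases i <;> simp)
      (fun i => by fin_cases i <;> simp [hB.le, hα.le])
      (fun i => by fin_cases i <;> exact isAlgebraic_one)
      (fun i => by fin_cases i <;> simp [hBalg, hαalg])
      (fun i => by
        fin_cases i
        · exact ⟨hdB, hiB1⟩
        · exact ⟨hdL, hiL1⟩)
      (by
        simp only [Fin.sum_univ_two, Matrix.cons_val_zero, Matrix.cons_val_one, div_one, Int.cast_neg,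
          Int.cast_mul]
        linear_combination hlog)
    have e : ∑ i : Fin 2, (![s * c, -m] i : ℤ) • KZ.of (![rB, rL] i) =
        (s * c) • KZ.of rB - m • KZ.of rL := by
      simp only [Fin.sum_univ_two, Matrix.cons_val_zero, Matrix.cons_val_one, neg_smul]
      abel
    rw [e] at h
    exact h
  -- assembly
  have e : M • KZ.of rI + k • KZ.of rP - m • KZ.of rL =
      s • (((q : ℤ) ^ 2) • KZ.of rI + ((p : ℤ) ^ 2) • KZ.of rP - c • KZ.of rB) +
        ((s * c) • KZ.of rB - m • KZ.of rL) := by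
    rw [hs, hk]
    module
  rw [e]
  exact KZ.relations.add_mem (KZ.relations.zsmul_mem hprim s) hL

/-- **The rung from stubs 1–2** (`<Rung>_of`): case split on the sign of `e₁`. [cite: KontsevichZagier2001, §1.2] -/
theorem neronTorsionShiftedSectors_of (h₁ : OverlapSector) (h₂ : ∀ ξ : ℚ, NewRegimeChainAt ξ) :
    NeronTorsionShiftedSectors := by
  intro ξ g₂ g₃ e₁ xP yP α N a M k m f hf hdisc he hξ hpos hx hy hN ha ha2 htie htor hρ hα rI rP rL hdI hiI
    hdP hiP hdL hiL hval
  by_cases he0 : 0 < e₁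
  · exact h₁ ξ g₂ g₃ e₁ xP yP α N a M k m f hf hdisc he he0 hξ hpos hx hy hN ha ha2 htie htor hρ hα rI rP rL
      hdI hiI hdP hiP hdL hiL hval
  · exact shiftedSector_of_shiftedChain ξ (h₂ ξ) g₂ g₃ e₁ xP yP α N a M k m f hf hdisc he hξ (not_lt.mp he0)
      hpos hx hy hN ha ha2 htie htor hρ hα rI rP rL hdI hiI hdP hiP hdL hiL hval

/-- The rung says exactly that every tied shifted element is a chain of moves: `closure T^{sh} ≤ KZ.relations`.
[cite: KontsevichZagier2001, §1.2] -/
theorem closure_shiftedTied_le_relations (h : NeronTorsionShiftedSectors) :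
    AddSubgroup.closure ShiftedTied ≤ Literature.NumberTheory.Transcendental.KZ.relations := by
  refine (AddSubgroup.closure_le _).mpr ?_
  rintro d ⟨ξ, g₂, g₃, e₁, xP, yP, α, N, a, M, k, m', f, rI, rP, rL, hf, hdisc, he, hξ, hpos, hx, hy, hN, ha,
    ha', htie, htor, hρ, hα, hdI, hiI, hdP, hiP, hdL, hiL, hval, rfl⟩
  exact h ξ g₂ g₃ e₁ xP yP α N a M k m' f hf hdisc he hξ hpos hx hy hN ha ha' htie htor hρ hα rI rP rL hdI hiI
    hdP hiP hdL hiL hval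

/-- **F3 WITNESS — the floor is the member `ξ = 0` of the family** (4 lines naming the seed `stub_assembly`;
`Rat.cast_zero`, `zero_mul`, `add_zero`, `sub_zero` by `simp`). -/
theorem neronTorsionShiftedSector_zero : NeronTorsionShiftedSector 0 := by
  simpa [NeronTorsionShiftedSector] using
    (NeronTorsionSector_of_primitiveChain stub_assembly :
      Summit.KontsevichZagierPeriods.KontsevichZagierPeriods.Theses.TorsionLogs.NeronTorsionSector)

/-- **F4 ON-PATH LEMMA — the summit implies the rung** (Conjecture 1 in kernel form,
`kzKernelConjecture_iff_isRational`; a tied element evaluates to `0` by its value hypothesis). Tagged `@[simp]` so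
that the tribunal's forward probe `S → Rung` closes by `intro h; aesop`. [cite: KontsevichZagier2001, §1.2] -/
@[simp] theorem neronTorsionShiftedSectors_of_kontsevichZagierPeriods (h : _root_.KontsevichZagierPeriods) :
    NeronTorsionShiftedSectors := by
  have hK : KZKernelConjecture := kzKernelConjecture_iff_isRational.mpr h
  intro ξ g₂ g₃ e₁ xP yP α N a M k m f _ _ _ _ _ _ _ _ _ _ _ _ _ _ rI rP rL _ _ _ _ _ _ hval
  apply hK
  rw [map_sub, map_add, map_zsmul, map_zsmul, map_zsmul, KZ.eval_of, KZ.eval_of, KZ.eval_of, zsmul_eq_mul,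
    zsmul_eq_mul, zsmul_eq_mul]
  linarith [hval]

/-- The residual is a consequence of the crux (hence of the summit): `T ⊆ T^{sh}` at `ξ = 0`, so
`relations ⊔ closure T ≤ relations ⊔ closure T^{sh}`. (Informational: stub 3 is WEAKER than the crux.) [folklore] -/
theorem shiftedSectorComplete_of_torsionSectorComplete (h : TorsionSectorComplete) : ShiftedSectorComplete := by
  intro n m r r' hr hr' hv
  have hmono : Literature.NumberTheory.Transcendental.KZ.relations ⊔ AddSubgroup.closure {d : Literature.NumberTheory.Transcendental.KZ.FormalRep | ∃ (g₂ g₃ e₁ xP yP α : ℝ) (N a : ℕ) (M k m : ℤ) (f : ℝ → ℝ) (rI rP : Literature.NumberTheory.Transcendental.KZ.IntegralRep 2) (rL : Literature.NumberTheory.Transcendental.KZ.IntegralRep 1), (∀ x, f x = 4 * x ^ 3 - g₂ * x - g₃) ∧ g₂ ^ 3 - 27 * g₃ ^ 2 ≠ 0 ∧ f e₁ = 0 ∧ 0 < e₁ ∧ (∀ x, e₁ < x → 0 < f x) ∧ e₁ < xP ∧ yP ^ 2 = f xP ∧ 3 ≤ N ∧ 0 < a ∧ 2 * a < N ∧ 4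 * (N : ℤ) ^ 2 * k = M * ((N : ℤ) - 2 * (a : ℤ)) ^ 2 ∧ (∀ hns : (⟨0, 0, 0, -g₂ / 4, -g₃ / 4⟩ : WeierstrassCurve ℝ).toAffine.Nonsingular xP (yP / 2), addOrderOf (WeierstrassCurve.Affine.Point.some xP (yP / 2) hns) = N) ∧ (N : ℝ) * (∫ x in Set.Ioi xP, (Real.sqrt (f x))⁻¹) = a * (2 * ∫ x in Set.Ioi e₁, (Real.sqrt (f x))⁻¹) ∧ 1 < α ∧ rI.domain = {z | e₁ < z 1 ∧ z 1 < z 0 ∧ z 0 < xP} ∧ Set.EqOn rI.integrand (fun z => z 1 / (Real.sqrt (f (z 1)) * Real.sqrt (f (z 0)))) rI.domain ∧ rP.domain = {z | e₁ < z 0 ∧ e₁ < z 1} ∧ Set.EqOn rP.integrand (fun z => (Real.sqrt (f (z 0)))⁻¹ * ((g₂ * z 1 + 2 * g₃) / (2 * (z 1) ^ 2 * Real.sqrt (f (z 1))))) rP.domain ∧ rL.domain = {t | 1 < t 0 ∧ t 0 < α} ∧ Set.EqOn rL.integrand (fun t => (t 0)⁻¹) rL.domain ∧ (M : ℝ) *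 rI.value + k * rP.value = m * rL.value ∧ d = M • Literature.NumberTheory.Transcendental.KZ.of rI + k • Literature.NumberTheory.Transcendental.KZ.of rP - m • Literature.NumberTheory.Transcendental.KZ.of rL} ≤
      Literature.NumberTheory.Transcendental.KZ.relations ⊔ AddSubgroup.closure ShiftedTied := by
    refine sup_le_sup_left ((AddSubgroup.closure_le _).mpr ?_) _
    rintro d ⟨g₂, g₃, e₁, xP, yP, α, N, a, M, k, m', f, rI, rP, rL, hf, hdisc, he, he0, hpos, hx, hy, hN, ha,
      ha', htie, htor, hρ, hα, hdI, hiI, hdP, hiP, hdL, hiL, hval, rfl⟩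
    refine AddSubgroup.subset_closure ⟨0, g₂, g₃, e₁, xP, yP, α, N, a, M, k, m', f, rI, rP, rL, hf, hdisc, he,
      by simpa using he0, hpos, hx, hy, hN, ha, ha', htie, htor, hρ, hα, hdI, hiI, hdP, ?_, hdL, hiL, hval, rfl⟩
    simpa using hiP
  exact hmono (h r r' hr hr' hv)

/-! ### Composition: the crux BY NAME from the three stubs -/

/-- **`TorsionSectorComplete` from the stubs** (closed term; `sorry` only through `stub_overlapSector`,
`stub_newRegimeChain`, `stub_shiftedComplete`): the rung (stubs 1–2, `neronTorsionShiftedSectors_of`) folds the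
shifted sector into the moves (`closure T^{sh} ≤ relations`), so the residual's `relations ⊔ closure T^{sh}` is
already `relations ≤ relations ⊔ closure T`. [cite: KontsevichZagier2001, §1.2] -/
theorem TorsionSectorComplete_of :
    Summit.KontsevichZagierPeriods.KontsevichZagierPeriods.Theses.TorsionLogs.TorsionSectorComplete := by
  suffices key : OverlapSector → (∀ ξ : ℚ, NewRegimeChainAt ξ) → ShiftedSectorComplete →
      Summit.KontsevichZagierPeriods.KontsevichZagierPeriods.Theses.TorsionLogs.TorsionSectorComplete from
    key stub_overlapSector stub_newRegimeChain stub_shiftedComplete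
  intro h₁ h₂ h₃ n m r r' hr hr' hv
  have hR : NeronTorsionShiftedSectors := neronTorsionShiftedSectors_of h₁ h₂
  have hle : Literature.NumberTheory.Transcendental.KZ.relations ⊔ AddSubgroup.closure ShiftedTied ≤
      Literature.NumberTheory.Transcendental.KZ.relations :=
    sup_le le_rfl (closure_shiftedTied_le_relations hR)
  exact AddSubgroup.mem_sup_left (hle (h₃ r r' hr hr' hv))

end Summit.KontsevichZagierPeriods.KontsevichZagierPeriods.Cruxes.TorsionSectorComplete.ShiftedEtaSector
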